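import Summits.BirchSwinnertonDyer.Rank1Residual.O5.HeegnerLogTransportThreeStepZeroEndTwoSidedShaAn
import Summits.BirchSwinnertonDyer.Rank1Residual.O5.HeegnerLogTransportThreeStepZeroEndTwoSidedCert
import Literature.NumberTheory.EllipticCurves.BSDHeegnerPointsModularityOnlyProofs
import HarnessLib
import HarnessLib.Audit.Tags

/-!
# Heegner-log transport at `p = 3` (KL3), part 29: part 27's two-sided END (twist side in the EXACT
# analytic currency `#Ш(G^{(d_K)})_an ∈ ℤ_{(3)}^×`) with the unit-log binder as a KERNEL LADDER CERTIFICATE,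
# and its ANALYTIC-RANK form (Gross–Zagier BY NAME) — o5-r2 GEN 29

HONEST FRAMING (cell `b2b-bsdres`, run/shared/lean/b2b/bsd-rank1-residual/, verbatim in every file): the
goal of the cell is to DELETE the COMBINATION-SHAPED residual classes of the Birch–Swinnerton-Dyer formula
for ALL analytic-rank `≤ 1` elliptic curves over `ℚ` — "full BSD formula for every rank `≤ 1` curve in
class `C`" assembled STRICTLY from published theorems — so that the rank-`≤ 1` remainder becomes exactly
the CONSTRUCTION-SHAPED classes, which are TYPED (missing-input `Prop`s), NOT attempted. This is not
"finishing BSD". Team O5 (tame potentially supersingular additive `p = 3`, (t′)), planner o5-r2 (the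
non-Iwasawa side), GEN 29; RESEARCH ROUTE; THEOREMS ONLY (bookkeeping over explicit hypotheses): no new
node is WANTED, no Literature fact, no `@[conjecture]`, no new object; NOTHING is booked and no mark of
`RESIDUAL-MAP.md` moves. O5 OPEN.

## What this file does (o5-r2 GEN 28 memo §G28-9 / GEN 29 memo §G29-7 (ii); NO new mathematics about (t′))

Part 27 (`O5/HeegnerLogTransportThreeStepZeroEndTwoSidedShaAn.lean`, o5-r2 GEN 28) re-displayed the two-sided END
with the twist's sharp `3`-descent `hSelGd : #Sel₃(G^{(d_K)}) = 3^{rk}` (a `3`-descent on a conductor-`N_G·d_K²` curve,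
not an instrument the cell has) REPLACED by the EXACT analytic statement
`hShaAnGd : ∃ q : ℚ, shaAn Gd = q ∧ padicValRat 3 q = 0` (`#Ш(G^{(d_K)})_an` is a `3`-adic unit; rank `0`, so this is
a finite exact modular-symbol computation — census A of o5-r2 GEN 28/29, EXACT `ord₃ #Ш_an(G_d) = 0` on the three rows
of record), in the `Q₀`-datum forms `…_cited_s0e` / `…_cited_s0e_rat`. This file supplies the two missing front-ends,
exactly as part 25b did for part 25:

* §1 `o5_index_unit_of_goodOrd_companion_cited_s0e_cert` — `…_s0e_rat` with `hQ₀`, `hQ₀unit` REPLACED by a rational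
  multiple certificate `m • Q₀ = (x_R, y_R)`, `0 < k`, `padicValRat 3 x_R = −2k`, `k − ord₃ m + ord₃ |G̃^{ns}(𝔽₃)| − 1 = 0`
  (part 24 core `valuation_padicLog_of_nsmul_eq`, which also PROVES `Q₀` non-torsion);
* §2 `o5_index_unit_of_goodOrd_companion_cited_s0e_ladder` — the point equality supplied by the tree's rational LADDER
  (`Supersingular.nsmul_some_eq_of_ladderRunQ`, `decide +kernel` per row), i.e. the shape the row files 25c/25d/25e use;
* §3 `o5_index_unit_of_goodOrd_companion_cited_s0e_ladder_analytic` — §2 with the two Heegner non-torsion binders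
  `hPinf`, `hP′inf` in ANALYTIC-RANK CURRENCY: `hGZW : gross_zagier N W K` (the Gross–Zagier formula BY NAME for `W/K`;
  for `G/K` the END already carries `hGZG`) and `han : analyticRankEK W K = 1`, `han′ : analyticRankEK G K = 1`, via the
  tree THEOREM `analyticRankEK_eq_one_iff_heegner_nonTorsion_of_exists_isNewformOf` (bsd.S16 corollary from
  `gross_zagier` + modularity) and Carayol's level theorem `IsNewformOf.level_eq_conductorNorm_of_exists_isNewformOf`
  (`N = N_W`, `N′ = N_G` DERIVED from `hmod` and `D`, `D′` — no level binder), as in part 28.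

What the ENDs STILL DISPLAY (honest list): Kriz–Li Thm. 1.16 (`hKL`), Yan–Zhu Thm. 4.15 (`hYZ`), Wuthrich Lemma 20
(`hW20`), modularity (`hmod`), Gross–Zagier–Kolyvagin rank (`hGZK`), Kolyvagin + Gross–Zagier for `G/K` (`hKoG`, `hGZG`)
BY NAME; `ρ̄_{W,3}` onto; the finitary binders (kernel-decidable per row); the Heegner / parametrisation data; `hPinf`,
`hP′inf` (§§1–2) or `hGZW`, `han`, `han′` (§3); the sharp `3`-descent of `G` itself (`hSelG`); `hShaAnGd`; the Manin
binders. Nothing about (t′) is claimed beyond these conditional implications; census = EVIDENCE, never a Literature fact.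

References: [cite: KrizLi2019, Theorem 1.16 (arXiv:1609.06687v4 pp. 7-8)] [cite: YanZhu2026, Theorem 4.15]
[cite: GrossZagier1986, Thm. I.6.3 with V.§2] [cite: Gross1991, (1.1)] [cite: Kolyvagin1990, Thm. A]
[cite: AtkinLehner1970, Thm. 4] [cite: DiamondShurman2005, Thm. 8.8.1] [cite: SilvermanAEC2009, IV.6.4 and VII.2.2]

## TYPER PLACEMENT NOTE

Place as `O5/HeegnerLogTransportThreeStepZeroEndTwoSidedShaAnCert.lean` AFTER part 27
(`O5/HeegnerLogTransportThreeStepZeroEndTwoSidedShaAn.lean`, in the tree 2026-08-23T12:01Z) and part 25b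
(`O5/HeegnerLogTransportThreeStepZeroEndTwoSidedCert.lean`, in the tree), which it imports, plus
`Literature/NumberTheory/EllipticCurves/BSDHeegnerPointsModularityOnlyProofs.lean` (in the tree); THEOREMS only (3),
namespace `Summit.BirchSwinnertonDyer.Rank1Residual.O5.HeegnerLogTransport`; 0 `def`, 0 `@[conjecture]`, 0 Literature
facts (net named-fact debt 0), no `sorry`. HONEST FRAMING as above; O5 OPEN; nothing booked.

### cc-typer-5 GEN 20 (O5 §3.5 / O6 §3.4 typer of record) — by-name ask A-O5-G29-1 of o5-r2 GEN 29 (HOME/INBOX.md l.15286 close + P.S. 1 l.15310 + P.S. 2 l.15330; by sha,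
VERBATIM + ¶; memo gen29/O5-GEN29.md) item (f) part 29 b6b0ac28631fc607 → O5/HeegnerLogTransportThreeStepZeroEndTwoSidedShaAnCert.lean. Source:
`HOME/b2b-bsdres-o5-r2/gen29/lean/HeegnerLogTransportThreeStepZeroEndTwoSidedShaAnCert.lean` sha16 `b6b0ac28631fc607` (245 l.; `gen29/SHA16.txt`; o5-r2's farm checks rc 0 / 0
warnings / 0 sorries, axioms standard, dedup clean as stated in their line), re-hashed by the typer right before writing; THIS file = the source VERBATIM + this paragraph
(imports, module text, every declaration block byte-identical; script `class-closure/typer-5/gen20/gplace.py`, docstring anchor asserted); imports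
`O5.HeegnerLogTransportThreeStepZeroEndTwoSidedShaAn`, `O5.HeegnerLogTransportThreeStepZeroEndTwoSidedCert`,
`Literature.NumberTheory.EllipticCurves.BSDHeegnerPointsModularityOnlyProofs` — all in the tree at filing; the typer's own standalone farm check on tree imports (rc 0 / 0
warnings / 0 sorries; `#print axioms` of the END(s) standard) and DEDUP (`lean search --decl` on the 3 new names: no match; the gate's statement-level dedup at dry-run) precede
the proposal. CONTENT LABELS: as the source's module text above states (declarations: `o5_index_unit_of_goodOrd_companion_cited_s0e_cert`,
`o5_index_unit_of_goodOrd_companion_cited_s0e_ladder`, `o5_index_unit_of_goodOrd_companion_cited_s0e_ladder_analytic`); 0 `@[conjecture]`, 0 Literature facts (net named-fact debt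
0), no `sorry`; published inputs stay displayed hypotheses BY NAME, nothing re-proved. HONEST FRAMING (cell `b2b-bsdres`): research route, lane CLASS-CLOSURE §3.5 O5; CONDITIONAL
ENDs — nothing asserted beyond the displayed binders, nothing booked, no mark / label / count / tier of `RESIDUAL-MAP.md` moves; census / instrument statements = EVIDENCE or
displayed binders, never a Literature fact; O5 OPEN.
-/

set_option autoImplicit false

noncomputable section

open scoped Classical

open WeierstrassCurve Literature.NumberTheory.EllipticCurves
  Literature.NumberTheory.EllipticCurves.ModularForms
  Literature.NumberTheory.EllipticCurves.Rank1Residual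
  Literature.NumberTheory.EllipticCurves.Rank1Residual.Typed
open Summit.BirchSwinnertonDyer.Rank1Residual.X11b (embAt)
open Summit.BirchSwinnertonDyer.Rank1Residual.Additive.LocalLog
open IsDedekindDomain (HeightOneSpectrum)
open scoped NumberField

namespace Summit.BirchSwinnertonDyer.Rank1Residual.O5.HeegnerLogTransport

/-! ## §1 Rational-multiple certificate front-end of part 27 -/

/-- **Two-sided END (twist side `#Ш(G^{(d_K)})_an ∈ ℤ_{(3)}^×`), rational-multiple certificate.** Part 27's
`o5_index_unit_of_goodOrd_companion_cited_s0e_rat` with `hQ₀`, `hQ₀unit` REPLACED by `m • Q₀ = (x_R, y_R) ∈ G(ℚ)`,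
`0 < k`, `ord₃ x_R = −2k` and the numeral identity `k − ord₃ m + ord₃ |G̃^{ns}(𝔽₃)| − 1 = 0`; part 24 core
(`valuation_padicLog_of_nsmul_eq`, odd `p`) gives `padicLog Q₀ ≠ 0` (so `Q₀` has infinite order) and
`ord₃ padicLog Q₀ = k − ord₃ m`. Conditional theorem; research route; O5 OPEN; nothing booked.
[cite: KrizLi2019, Thm. 1.16, Rem. 1.17] [cite: YanZhu2026, Theorem 4.15] [cite: SilvermanAEC2009, IV.6.4 and VII.2.2] -/
theorem o5_index_unit_of_goodOrd_companion_cited_s0e_cert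
    (hKL : KrizLi2019.thm116_padicLogHeegner_congruence)
    (hYZ : YanZhu2026.thm415_padicValRat_bsd_rank_le_one)
    (hW20 : Wuthrich2014.lemma20_surjective_threeAdic_of_semistable)
    (hmod : exists_isNewformOf) (hGZK : rank_eq_analyticRank_of_analyticRank_le_one)
    (W G : WeierstrassCurve ℚ) [W.IsElliptic] [W.IsGloballyMinimal] [G.IsElliptic] [G.IsGloballyMinimal]
    (hcong : ∀ ℓ : ℕ, ℓ.Prime → ¬ (ℓ ∣ 3 * W.conductorNorm ℤ * G.conductorNorm ℤ) →
      ((W.LFunction ℓ : ℤ) : ZMod 3) = ((G.LFunction ℓ : ℤ) : ZMod 3))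
    (hρ : W.HasSurjectiveModNGaloisRep 3) (hadd : Addv W 3)
    (hunitW : ∀ ℓ ∈ klSet W G, ℓ ≠ 3 → padicValInt 3 (nsCount W ℓ) = 0)
    (hunitG : ∀ ℓ ∈ klSet G W, ℓ ≠ 3 → padicValInt 3 (nsCount G ℓ) = 0)
    (htam : ¬ 3 ∣ W.tamagawaProduct) (htamG : ¬ 3 ∣ G.tamagawaProduct) (hordG : GoodOrd G 3)
    (Gd : WeierstrassCurve ℚ) [Gd.IsElliptic] [Gd.IsGloballyMinimal] (htamGd : ¬ 3 ∣ Gd.tamagawaProduct)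
    {N N' : ℕ} [NeZero N] [NeZero N'] (D : ModularParametrizationData W N)
    (D' : ModularParametrizationData G N')
    (K : Type) [Field K] [NumberField K] (hK : IsImaginaryQuadratic K)
    (hH : SatisfiesHeegnerHypothesis N K) (hH' : SatisfiesHeegnerHypothesis N' K)
    (h3K : SatisfiesHeegnerHypothesis 3 K)
    (hKoG : kolyvagin N' G K) (hGZG : gross_zagier N' G K)
    (hd : NumberField.discr K < -4)
    (hGd : ∃ C : VariableChange ℚ, C • G.quadraticTwist (NumberField.discr K : ℚ) = Gd)
    (H : HeegnerDatum N (NumberField.discr K)) (H' : HeegnerDatum N' (NumberField.discr K))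
    (ι : K →+* ℂ) (ι₃ : K →+* ℚ_[3])
    (P : (W.baseChange K).toAffine.Point) (P' : (G.baseChange K).toAffine.Point)
    (hP : WeierstrassCurve.Affine.Point.map ι.toRatAlgHom P = heegnerPointComplex D H)
    (hP' : WeierstrassCurve.Affine.Point.map ι.toRatAlgHom P' = heegnerPointComplex D' H')
    (hPinf : ¬ IsOfFinAddOrder P) (hP'inf : ¬ IsOfFinAddOrder P')
    (Q₀ : G.toAffine.Point) {xR yR : ℚ} {hR : G.toAffine.Nonsingular xR yR} {m k : ℕ}
    (hm : m • Q₀ = .some xR yR hR) (hk : 0 < k) (hx : padicValRat 3 xR = -(2 * (k : ℤ)))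
    (hmk : (k : ℤ) - padicValNat 3 m + padicValInt 3 (nsCount G 3) - 1 = 0)
    (hSelG : Nat.card (G.selmerGroup (3 : ℤ)) = 3 ^ G.mordellWeilRank)
    (hShaAnGd : ∃ q : ℚ, shaAn Gd = (q : ℂ) ∧ padicValRat 3 q = 0)
    (hcD : padicValInt 3 D.maninConstant = 0) (hc3' : ¬ ((3 : ℤ) ∣ D'.maninConstant)) :
    padicValNat 3 (AddSubgroup.zmultiples P).index = 0 := by
  haveI : Fact (Nat.Prime 3) := ⟨Nat.prime_three⟩
  have hm' : m • Affine.Point.map (W' := G.toAffine) (S := ℚ) (Algebra.ofId ℚ ℚ_[3]) Q₀ =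
      Affine.Point.map (W' := G.toAffine) (S := ℚ) (Algebra.ofId ℚ ℚ_[3]) (.some xR yR hR) := by
    rw [← map_nsmul]; exact congrArg _ hm
  rw [Affine.Point.map_some] at hm'
  have hx' : ((Algebra.ofId ℚ ℚ_[3]) xR).valuation = -(2 * (k : ℤ)) := by
    rw [show (Algebra.ofId ℚ ℚ_[3]) xR = (xR : ℚ_[3]) from eq_ratCast _ xR, Padic.valuation_ratCast, hx]
  obtain ⟨hnt, hval⟩ :=
    valuation_padicLog_of_nsmul_eq (G.baseChange ℚ_[3]) (by norm_num) hm' hk hx'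
  have hQ₀ : ¬ IsOfFinAddOrder Q₀ := fun h =>
    hnt ((padicLog_eq_zero_iff (G.baseChange ℚ_[3]) _).mpr (AddMonoidHom.isOfFinAddOrder _ h))
  have hQ₀unit : (padicLog (G.baseChange ℚ_[3])
        (Affine.Point.map (W' := G.toAffine) (S := ℚ) (Algebra.ofId ℚ ℚ_[3]) Q₀)).valuation +
      padicValInt 3 (nsCount G 3) - 1 = 0 := by
    rw [hval]; exact hmk
  exact o5_index_unit_of_goodOrd_companion_cited_s0e_rat hKL hYZ hW20 hmod hGZK W G hcong hρ hadd hunitW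
    hunitG htam htamG hordG Gd htamGd D D' K hK hH hH' h3K hKoG hGZG hd hGd H H' ι ι₃ P P' hP hP' hPinf hP'inf
    Q₀ hQ₀ hQ₀unit hSelG hShaAnGd hcD hc3'

/-! ## §2 Ladder front-end (`Supersingular.ladderRunQ`, `decide +kernel` per row) -/

/-- **Two-sided END (twist side `#Ш(G^{(d_K)})_an ∈ ℤ_{(3)}^×`), ladder form of the unit-log certificate.** §1 with
the point equality `m • Q₀ = (x_R, y_R)` SUPPLIED by the tree's rational ladder: a base point `(x₀, y₀) ∈ G(ℚ)` (`h₀`),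
ladder steps replayed by `Supersingular.ladderRunQ` to `(x_f, y_f)` (`hrun`), `m = qScalar 1 steps`, and the two numeral
checks `padicValRat 3 x_f = −2k`, `k − ord₃ m + ord₃ |G̃^{ns}(𝔽₃)| − 1 = 0` — the shape of the row files 25c/25d/25e, whose
kernel certificates are reused unchanged by the row re-displays. Conditional theorem; research route; O5 OPEN; nothing booked.
[cite: KrizLi2019, Thm. 1.16, Rem. 1.17] [cite: YanZhu2026, Theorem 4.15] [cite: SilvermanAEC2009, III.2.3, IV.6.4 and VII.2.2] -/
theorem o5_index_unit_of_goodOrd_companion_cited_s0e_ladder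
    (hKL : KrizLi2019.thm116_padicLogHeegner_congruence)
    (hYZ : YanZhu2026.thm415_padicValRat_bsd_rank_le_one)
    (hW20 : Wuthrich2014.lemma20_surjective_threeAdic_of_semistable)
    (hmod : exists_isNewformOf) (hGZK : rank_eq_analyticRank_of_analyticRank_le_one)
    (W G : WeierstrassCurve ℚ) [W.IsElliptic] [W.IsGloballyMinimal] [G.IsElliptic] [G.IsGloballyMinimal]
    (hcong : ∀ ℓ : ℕ, ℓ.Prime → ¬ (ℓ ∣ 3 * W.conductorNorm ℤ * G.conductorNorm ℤ) →
      ((W.LFunction ℓ : ℤ) : ZMod 3) = ((G.LFunction ℓ : ℤ) : ZMod 3))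
    (hρ : W.HasSurjectiveModNGaloisRep 3) (hadd : Addv W 3)
    (hunitW : ∀ ℓ ∈ klSet W G, ℓ ≠ 3 → padicValInt 3 (nsCount W ℓ) = 0)
    (hunitG : ∀ ℓ ∈ klSet G W, ℓ ≠ 3 → padicValInt 3 (nsCount G ℓ) = 0)
    (htam : ¬ 3 ∣ W.tamagawaProduct) (htamG : ¬ 3 ∣ G.tamagawaProduct) (hordG : GoodOrd G 3)
    (Gd : WeierstrassCurve ℚ) [Gd.IsElliptic] [Gd.IsGloballyMinimal] (htamGd : ¬ 3 ∣ Gd.tamagawaProduct)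
    {N N' : ℕ} [NeZero N] [NeZero N'] (D : ModularParametrizationData W N)
    (D' : ModularParametrizationData G N')
    (K : Type) [Field K] [NumberField K] (hK : IsImaginaryQuadratic K)
    (hH : SatisfiesHeegnerHypothesis N K) (hH' : SatisfiesHeegnerHypothesis N' K)
    (h3K : SatisfiesHeegnerHypothesis 3 K)
    (hKoG : kolyvagin N' G K) (hGZG : gross_zagier N' G K)
    (hd : NumberField.discr K < -4)
    (hGd : ∃ C : VariableChange ℚ, C • G.quadraticTwist (NumberField.discr K : ℚ) = Gd)
    (H : HeegnerDatum N (NumberField.discr K)) (H' : HeegnerDatum N' (NumberField.discr K))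
    (ι : K →+* ℂ) (ι₃ : K →+* ℚ_[3])
    (P : (W.baseChange K).toAffine.Point) (P' : (G.baseChange K).toAffine.Point)
    (hP : WeierstrassCurve.Affine.Point.map ι.toRatAlgHom P = heegnerPointComplex D H)
    (hP' : WeierstrassCurve.Affine.Point.map ι.toRatAlgHom P' = heegnerPointComplex D' H')
    (hPinf : ¬ IsOfFinAddOrder P) (hP'inf : ¬ IsOfFinAddOrder P')
    {x₀ y₀ xf yf : ℚ} (h₀ : G.toAffine.Nonsingular x₀ y₀) (steps : List Supersingular.QStep)
    (hrun : Supersingular.ladderRunQ G.a₁ G.a₂ G.a₃ G.a₄ x₀ y₀ x₀ y₀ steps = some (xf, yf))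
    {k : ℕ} (hk : 0 < k) (hx : padicValRat 3 xf = -(2 * (k : ℤ)))
    (hmk : (k : ℤ) - padicValNat 3 (Supersingular.qScalar 1 steps) + padicValInt 3 (nsCount G 3) - 1 = 0)
    (hSelG : Nat.card (G.selmerGroup (3 : ℤ)) = 3 ^ G.mordellWeilRank)
    (hShaAnGd : ∃ q : ℚ, shaAn Gd = (q : ℂ) ∧ padicValRat 3 q = 0)
    (hcD : padicValInt 3 D.maninConstant = 0) (hc3' : ¬ ((3 : ℤ) ∣ D'.maninConstant)) :
    padicValNat 3 (AddSubgroup.zmultiples P).index = 0 := by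
  obtain ⟨hf, hm⟩ := Supersingular.nsmul_some_eq_of_ladderRunQ h₀ steps hrun
  exact o5_index_unit_of_goodOrd_companion_cited_s0e_cert hKL hYZ hW20 hmod hGZK W G hcong hρ hadd hunitW
    hunitG htam htamG hordG Gd htamGd D D' K hK hH hH' h3K hKoG hGZG hd hGd H H' ι ι₃ P P' hP hP' hPinf hP'inf
    (.some x₀ y₀ h₀) hm hk hx hmk hSelG hShaAnGd hcD hc3'

/-! ## §3 The same END with the two Heegner non-torsion binders in ANALYTIC-RANK CURRENCY (as part 28) -/

/-- **Two-sided END (twist side `#Ш(G^{(d_K)})_an ∈ ℤ_{(3)}^×`), ladder form, ANALYTIC-RANK CURRENCY.** §2 with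
`hPinf`, `hP′inf` REPLACED by the Gross–Zagier formula for `W/K` BY NAME (`hGZW : gross_zagier N W K`; for `G/K` the END
already carries `hGZG`) and `ord_{s=1} L(W/K, s) = 1`, `ord_{s=1} L(G/K, s) = 1` (`han`, `han′`): the displayed `P`, `P′`
ARE Heegner points of levels `N = N_W`, `N′ = N_G` (levels forced by `hmod` and `D`, `D′`, Carayol), so the tree theorem
`analyticRankEK_eq_one_iff_heegner_nonTorsion_of_exists_isNewformOf` (bsd.S16 corollary, from `gross_zagier` +
modularity) converts `han`, `han′` into their non-torsion. Conditional theorem; research route; O5 OPEN; nothing booked.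
[cite: KrizLi2019, Thm. 1.16, Rem. 1.17] [cite: YanZhu2026, Theorem 4.15] [cite: GrossZagier1986, Thm. I.6.3 with V.§2]
[cite: Gross1991, (1.1)] [cite: AtkinLehner1970, Thm. 4] -/
theorem o5_index_unit_of_goodOrd_companion_cited_s0e_ladder_analytic
    (hKL : KrizLi2019.thm116_padicLogHeegner_congruence)
    (hYZ : YanZhu2026.thm415_padicValRat_bsd_rank_le_one)
    (hW20 : Wuthrich2014.lemma20_surjective_threeAdic_of_semistable)
    (hmod : exists_isNewformOf) (hGZK : rank_eq_analyticRank_of_analyticRank_le_one)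
    (W G : WeierstrassCurve ℚ) [W.IsElliptic] [W.IsGloballyMinimal] [G.IsElliptic] [G.IsGloballyMinimal]
    (hcong : ∀ ℓ : ℕ, ℓ.Prime → ¬ (ℓ ∣ 3 * W.conductorNorm ℤ * G.conductorNorm ℤ) →
      ((W.LFunction ℓ : ℤ) : ZMod 3) = ((G.LFunction ℓ : ℤ) : ZMod 3))
    (hρ : W.HasSurjectiveModNGaloisRep 3) (hadd : Addv W 3)
    (hunitW : ∀ ℓ ∈ klSet W G, ℓ ≠ 3 → padicValInt 3 (nsCount W ℓ) = 0)
    (hunitG : ∀ ℓ ∈ klSet G W, ℓ ≠ 3 → padicValInt 3 (nsCount G ℓ) = 0)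
    (htam : ¬ 3 ∣ W.tamagawaProduct) (htamG : ¬ 3 ∣ G.tamagawaProduct) (hordG : GoodOrd G 3)
    (Gd : WeierstrassCurve ℚ) [Gd.IsElliptic] [Gd.IsGloballyMinimal] (htamGd : ¬ 3 ∣ Gd.tamagawaProduct)
    {N N' : ℕ} [NeZero N] [NeZero N'] (D : ModularParametrizationData W N)
    (D' : ModularParametrizationData G N')
    (K : Type) [Field K] [NumberField K] (hK : IsImaginaryQuadratic K)
    (hH : SatisfiesHeegnerHypothesis N K) (hH' : SatisfiesHeegnerHypothesis N' K)
    (h3K : SatisfiesHeegnerHypothesis 3 K)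
    (hKoG : kolyvagin N' G K) (hGZW : gross_zagier N W K) (hGZG : gross_zagier N' G K)
    (hd : NumberField.discr K < -4)
    (hGd : ∃ C : VariableChange ℚ, C • G.quadraticTwist (NumberField.discr K : ℚ) = Gd)
    (H : HeegnerDatum N (NumberField.discr K)) (H' : HeegnerDatum N' (NumberField.discr K))
    (ι : K →+* ℂ) (ι₃ : K →+* ℚ_[3])
    (P : (W.baseChange K).toAffine.Point) (P' : (G.baseChange K).toAffine.Point)
    (hP : WeierstrassCurve.Affine.Point.map ι.toRatAlgHom P = heegnerPointComplex D H)
    (hP' : WeierstrassCurve.Affine.Point.map ι.toRatAlgHom P' = heegnerPointComplex D' H')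
    (han : analyticRankEK W K = 1) (han' : analyticRankEK G K = 1)
    {x₀ y₀ xf yf : ℚ} (h₀ : G.toAffine.Nonsingular x₀ y₀) (steps : List Supersingular.QStep)
    (hrun : Supersingular.ladderRunQ G.a₁ G.a₂ G.a₃ G.a₄ x₀ y₀ x₀ y₀ steps = some (xf, yf))
    {k : ℕ} (hk : 0 < k) (hx : padicValRat 3 xf = -(2 * (k : ℤ)))
    (hmk : (k : ℤ) - padicValNat 3 (Supersingular.qScalar 1 steps) + padicValInt 3 (nsCount G 3) - 1 = 0)
    (hSelG : Nat.card (G.selmerGroup (3 : ℤ)) = 3 ^ G.mordellWeilRank)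
    (hShaAnGd : ∃ q : ℚ, shaAn Gd = (q : ℂ) ∧ padicValRat 3 q = 0)
    (hcD : padicValInt 3 D.maninConstant = 0) (hc3' : ¬ ((3 : ℤ) ∣ D'.maninConstant)) :
    padicValNat 3 (AddSubgroup.zmultiples P).index = 0 :=
  o5_index_unit_of_goodOrd_companion_cited_s0e_ladder hKL hYZ hW20 hmod hGZK W G hcong hρ hadd hunitW hunitG htam
    htamG hordG Gd htamGd D D' K hK hH hH' h3K hKoG hGZG hd hGd H H' ι ι₃ P P' hP hP'
    ((analyticRankEK_eq_one_iff_heegner_nonTorsion_of_exists_isNewformOf W N K hGZW hmod hK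
      (IsNewformOf.level_eq_conductorNorm_of_exists_isNewformOf hmod D.isNewformOf).symm hH ⟨D, H, ι, hP⟩).mp han)
    ((analyticRankEK_eq_one_iff_heegner_nonTorsion_of_exists_isNewformOf G N' K hGZG hmod hK
      (IsNewformOf.level_eq_conductorNorm_of_exists_isNewformOf hmod D'.isNewformOf).symm hH' ⟨D', H', ι, hP'⟩).mp han')
    h₀ steps hrun hk hx hmk hSelG hShaAnGd hcD hc3'

end Summit.BirchSwinnertonDyer.Rank1Residual.O5.HeegnerLogTransport

end
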